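import Summits.ResolutionOfSingularities.ResolutionOfSingularities.Theorems.EquisingularLiftEquisingularLiftNatDirectionCentreRegular
import HarnessLib

/-!
# [OURS · L1 W4.5(b) · EL♮(3)] T-DIRLIFT part D3a — THE DIRECTION CENTRE ON A CHART, RING LEVEL:
# `A[I/c_i] ⧸ 𝔞 ≅ A ⧸ I` COMPATIBLY WITH `A`, `𝔞 ∩ A = I`, `A[I/c_i] = A + 𝔞`, the unique prime over `𝔪`, and the local ring
# `A[I/c_i]_𝔔 ⧸ 𝔞` as a quotient of `A`

Crux chain w45b (cell `res-hironaka`, slot W4.5(b)), working crux **EL♮** = stmt-ResolutionOfSingularities-20038, child **EL♮(3)** =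
stmt-ResolutionOfSingularities-20148, route EquisingularLift, line `sections`; supplier object **T-DIRLIFT** (plan-1 CHAIN v7.24 O2;
res-type-027 credited), part D3a = the ring core of D3 «`V(Γ̃) ≅ C` over `X`» (consumer: res-D-pv-029 g8's `towerRoundCech_brick`).
HONEST FRAMING: OURS; NOT a statement of any manuscript; AI-written, weaker than expert review. No `sorry`; standard axioms. DEF-FREE.
`--supports stmt-ResolutionOfSingularities-20148 --as helper`.

SETTING. `A` a commutative ring, `x : Fin r → A` (quasi-regular where said), `I = (x)`, the chart algebra `B = A[I/x_i]`
(`blowupAlgebra`), and the DIRECTION-CENTRE IDEAL of the chart `𝔞 = (x_i/1) + (x_j/x_i : j ≠ i)` (for `r = 2`, `i = 1`, a frame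
`(ℓ, m)`: `𝔞 = (m, ℓ/m)`, the chart ideal of `Γ̃ = controlledTransform τ I 𝒟 1`, …NatDirectionCentre p547943).

WHAT.
* `exists_quotient_directionCentre_equiv` — **`ε : B ⧸ 𝔞 ≃+* A ⧸ I` with `ε [a/1] = [a]`** (`x` quasi-regular; via `RingHom.liftOfSurjective`
  along the presentation `eval : A[T] ↠ B`).
* `comap_algebraMap_directionCentre` — `𝔞 ∩ A = I`; `exists_sub_algebraMap_mem_directionCentre` — `B = A + 𝔞`;
  `eq_directionCentre_sup_map_comap` / `eq_of_directionCentre_le_of_comap_eq` — an ideal `𝔔 ⊇ 𝔞` is `𝔞 + (𝔔 ∩ A)·B`, so it is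
  determined by `𝔔 ∩ A`; `isPrime_directionCentre_sup_map` — for a prime `P ⊇ I` of `A`, `𝔞 + P·B` is prime with `(𝔞 + P·B) ∩ A = P`.
* `surjective_mk_map_directionCentre_comp` / `comap_map_directionCentre` — for `A` local and `S = B_𝔔` (`𝔔 ⊇ 𝔞` a prime over `𝔪_A`):
  **`A → S ⧸ 𝔞S` is surjective with kernel `I`** (the stalk of `V(Γ̃)` is the stalk of `C`).

References: The Stacks Project, Tags 052P, 0804 — through the tree (`BlowupAlgebraPresentation`: `eval`, `eval_C`, `eval_surjective`,
`comap_eval_span_algebraMap_eq`; …NatDirectionCentreRegular: `map_eval_comap_constantCoeff_eq_span_sup`, `sub_C_constantCoeff_mem_span_X`;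
…NatNonEquimultipleStrictTransform p543997: `map_C_le_comap_constantCoeff`).
-/

set_option linter.dupNamespace false -- mandated namespace `Summit.<Summit>.<Problem>` of this single-conjunct summit

noncomputable section

open IsLocalRing
open Literature.AlgebraicGeometry.Resolution

namespace Summit.ResolutionOfSingularities.ResolutionOfSingularities.Cruxes.EquisingularLiftNat.Sections

universe u

section Chart

variable {A : Type u} [CommRing A] {r : ℕ} (x : Fin r → A) (i : Fin r)

/-- **`A[I/x_i] ⧸ 𝔞 ≅ A ⧸ I` compatibly with `A`** (`x` quasi-regular): there is a ring isomorphism `ε` with `ε [a/1] = [a]`.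
Construction: `eval : A[T_j : j ≠ i] ↠ A[I/x_i]` has kernel inside `M = {p : p(0) ∈ I}` (quasi-regularity), so `p ↦ [p(0)]` descends
to `ψ : A[I/x_i] → A ⧸ I`, surjective with kernel `eval(M) = 𝔞`. [cite: StacksProject, Tag 052P] -/
theorem exists_quotient_directionCentre_equiv (hx : IsQuasiRegular x) :
    ∃ ε : (blowupAlgebra (Ideal.span (Set.range x)) (x i) ⧸
        (Ideal.span {algebraMap A (blowupAlgebra (Ideal.span (Set.range x)) (x i)) (x i)} ⊔
          Ideal.span (Set.range fun j : {j : Fin r // j ≠ i} => blowupAlgebra.frac x i j.1))) ≃+*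
      (A ⧸ Ideal.span (Set.range x)),
      ∀ a : A, ε (Ideal.Quotient.mk _ (algebraMap A _ a)) = Ideal.Quotient.mk _ a := by
  have hM : RingHom.ker (blowupAlgebra.eval x i).toRingHom ≤
      (Ideal.span (Set.range x)).comap (MvPolynomial.constantCoeff : MvPolynomial {j : Fin r // j ≠ i} A →+* A) := by
    refine le_trans ?_ (map_C_le_comap_constantCoeff _)
    rw [← blowupAlgebra.comap_eval_span_algebraMap_eq x i hx, RingHom.ker_eq_comap_bot]
    exact Ideal.comap_mono bot_le
  have hkerg : RingHom.ker ((Ideal.Quotient.mk (Ideal.span (Set.range x))).comp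
      (MvPolynomial.constantCoeff : MvPolynomial {j : Fin r // j ≠ i} A →+* A)) =
      (Ideal.span (Set.range x)).comap (MvPolynomial.constantCoeff : MvPolynomial {j : Fin r // j ≠ i} A →+* A) := by
    rw [← RingHom.comap_ker, Ideal.mk_ker]
  -- `ψ : B → A ⧸ I`, `eval p ↦ [p(0)]`
  let ψ : blowupAlgebra (Ideal.span (Set.range x)) (x i) →+* A ⧸ Ideal.span (Set.range x) :=
    (blowupAlgebra.eval x i).toRingHom.liftOfSurjective (fun b => blowupAlgebra.eval_surjective x i b)
      ⟨(Ideal.Quotient.mk (Ideal.span (Set.range x))).comp MvPolynomial.constantCoeff, by rw [hkerg]; exact hM⟩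
  have hψ : ∀ p, ψ (blowupAlgebra.eval x i p) = Ideal.Quotient.mk _ (MvPolynomial.constantCoeff p) := fun p =>
    (blowupAlgebra.eval x i).toRingHom.liftOfSurjective_comp_apply (fun b => blowupAlgebra.eval_surjective x i b) _ p
  have hψa : ∀ a : A, ψ (algebraMap A _ a) = Ideal.Quotient.mk _ a := fun a => by
    rw [← blowupAlgebra.eval_C x i a, hψ, MvPolynomial.constantCoeff_C]
  have hψsurj : Function.Surjective ψ := fun q => by
    obtain ⟨a, rfl⟩ := Ideal.Quotient.mk_surjective q
    exact ⟨algebraMap A _ a, hψa a⟩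
  have hkerψ : RingHom.ker ψ = Ideal.span {algebraMap A (blowupAlgebra (Ideal.span (Set.range x)) (x i)) (x i)} ⊔
      Ideal.span (Set.range fun j : {j : Fin r // j ≠ i} => blowupAlgebra.frac x i j.1) := by
    rw [← map_eval_comap_constantCoeff_eq_span_sup]
    apply le_antisymm
    · intro b hb
      obtain ⟨p, rfl⟩ := blowupAlgebra.eval_surjective x i b
      have hp : p ∈ (Ideal.span (Set.range x)).comap
          (MvPolynomial.constantCoeff : MvPolynomial {j : Fin r // j ≠ i} A →+* A) := by
        rw [Ideal.mem_comap, ← Ideal.Quotient.eq_zero_iff_mem, ← hψ]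
        exact hb
      exact Ideal.mem_map_of_mem _ hp
    · rw [Ideal.map_le_iff_le_comap]
      intro p hp
      rw [Ideal.mem_comap] at hp
      rw [Ideal.mem_comap, RingHom.mem_ker]
      change ψ (blowupAlgebra.eval x i p) = 0
      rw [hψ, Ideal.Quotient.eq_zero_iff_mem]
      exact hp
  refine ⟨(Ideal.quotEquivOfEq hkerψ.symm).trans (RingHom.quotientKerEquivOfSurjective hψsurj), fun a => ?_⟩
  rw [RingEquiv.trans_apply, Ideal.quotEquivOfEq_mk, RingHom.quotientKerEquivOfSurjective_apply_mk, hψa]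

/-- **`𝔞 ∩ A = I`** (`x` quasi-regular). [cite: StacksProject, Tag 052P] -/
theorem comap_algebraMap_directionCentre (hx : IsQuasiRegular x) :
    (Ideal.span {algebraMap A (blowupAlgebra (Ideal.span (Set.range x)) (x i)) (x i)} ⊔
        Ideal.span (Set.range fun j : {j : Fin r // j ≠ i} => blowupAlgebra.frac x i j.1)).comap
      (algebraMap A (blowupAlgebra (Ideal.span (Set.range x)) (x i))) = Ideal.span (Set.range x) := by
  obtain ⟨ε, hε⟩ := exists_quotient_directionCentre_equiv x i hx
  ext a
  rw [Ideal.mem_comap, ← Ideal.Quotient.eq_zero_iff_mem, ← Ideal.Quotient.eq_zero_iff_mem (I := Ideal.span (Set.range x)),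
    ← hε, map_eq_zero_iff ε ε.injective]

/-- **`B = A + 𝔞`**: every element of the chart algebra is congruent to an element of `A` modulo the direction-centre ideal
(a polynomial in the `x_j/x_i` is congruent to its constant term modulo `(x_j/x_i : j ≠ i)`). [folklore] -/
theorem exists_sub_algebraMap_mem_directionCentre (b : blowupAlgebra (Ideal.span (Set.range x)) (x i)) :
    ∃ a : A, b - algebraMap A _ a ∈
      Ideal.span {algebraMap A (blowupAlgebra (Ideal.span (Set.range x)) (x i)) (x i)} ⊔
        Ideal.span (Set.range fun j : {j : Fin r // j ≠ i} => blowupAlgebra.frac x i j.1) := by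
  obtain ⟨p, rfl⟩ := blowupAlgebra.eval_surjective x i b
  refine ⟨MvPolynomial.constantCoeff p, ?_⟩
  rw [← blowupAlgebra.eval_C x i (MvPolynomial.constantCoeff p), ← map_sub, ← map_eval_comap_constantCoeff_eq_span_sup]
  refine Ideal.mem_map_of_mem _ ?_
  rw [Ideal.mem_comap, map_sub, MvPolynomial.constantCoeff_C, sub_self]
  exact zero_mem _

/-- An ideal `𝔔 ⊇ 𝔞` of the chart algebra is `𝔞 + (𝔔 ∩ A)·B`. [folklore] -/
theorem eq_directionCentre_sup_map_comap {𝔔 : Ideal (blowupAlgebra (Ideal.span (Set.range x)) (x i))}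
    (h𝔞𝔔 : Ideal.span {algebraMap A (blowupAlgebra (Ideal.span (Set.range x)) (x i)) (x i)} ⊔
        Ideal.span (Set.range fun j : {j : Fin r // j ≠ i} => blowupAlgebra.frac x i j.1) ≤ 𝔔) :
    𝔔 = Ideal.span {algebraMap A (blowupAlgebra (Ideal.span (Set.range x)) (x i)) (x i)} ⊔
        Ideal.span (Set.range fun j : {j : Fin r // j ≠ i} => blowupAlgebra.frac x i j.1) ⊔
      (𝔔.comap (algebraMap A _)).map (algebraMap A _) := by
  refine le_antisymm (fun b hb => ?_) (sup_le h𝔞𝔔 Ideal.map_comap_le)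
  obtain ⟨a, ha⟩ := exists_sub_algebraMap_mem_directionCentre x i b
  have hab : algebraMap A _ a ∈ 𝔔 := by
    have h := 𝔔.sub_mem hb (h𝔞𝔔 ha)
    rwa [sub_sub_cancel] at h
  have h : b = (b - algebraMap A _ a) + algebraMap A _ a := by ring
  rw [h]
  exact Ideal.add_mem _ (Ideal.mem_sup_left ha) (Ideal.mem_sup_right (Ideal.mem_map_of_mem _ (Ideal.mem_comap.mpr hab)))

/-- **Ideals `⊇ 𝔞` are determined by their trace on `A`.** In particular two primes of the chart containing the direction-centre
ideal and lying over the same prime of `A` coincide (uniqueness of the point of `V(Γ̃)` over a point of `C`). [folklore] -/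
theorem eq_of_directionCentre_le_of_comap_eq {𝔔₁ 𝔔₂ : Ideal (blowupAlgebra (Ideal.span (Set.range x)) (x i))}
    (h₁ : Ideal.span {algebraMap A (blowupAlgebra (Ideal.span (Set.range x)) (x i)) (x i)} ⊔
        Ideal.span (Set.range fun j : {j : Fin r // j ≠ i} => blowupAlgebra.frac x i j.1) ≤ 𝔔₁)
    (h₂ : Ideal.span {algebraMap A (blowupAlgebra (Ideal.span (Set.range x)) (x i)) (x i)} ⊔
        Ideal.span (Set.range fun j : {j : Fin r // j ≠ i} => blowupAlgebra.frac x i j.1) ≤ 𝔔₂)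
    (h : 𝔔₁.comap (algebraMap A _) = 𝔔₂.comap (algebraMap A _)) : 𝔔₁ = 𝔔₂ := by
  rw [eq_directionCentre_sup_map_comap x i h₁, eq_directionCentre_sup_map_comap x i h₂, h]

/-- **The prime of the chart over a prime `P ⊇ I` of `A`**: `𝔞 + P·B` is prime and meets `A` in `P` (`x` quasi-regular) — under
`ε : B ⧸ 𝔞 ≅ A ⧸ I` it corresponds to `P ⧸ I`. (Existence of the point of `V(Γ̃)` over every point of `C`.) [cite: StacksProject, Tag 052P] -/
theorem isPrime_directionCentre_sup_map (hx : IsQuasiRegular x) (P : Ideal A) [P.IsPrime] (hIP : Ideal.span (Set.range x) ≤ P) :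
    (Ideal.span {algebraMap A (blowupAlgebra (Ideal.span (Set.range x)) (x i)) (x i)} ⊔
          Ideal.span (Set.range fun j : {j : Fin r // j ≠ i} => blowupAlgebra.frac x i j.1) ⊔
        P.map (algebraMap A _)).IsPrime ∧
      (Ideal.span {algebraMap A (blowupAlgebra (Ideal.span (Set.range x)) (x i)) (x i)} ⊔
            Ideal.span (Set.range fun j : {j : Fin r // j ≠ i} => blowupAlgebra.frac x i j.1) ⊔
          P.map (algebraMap A _)).comap (algebraMap A _) = P := by
  set 𝔞 : Ideal (blowupAlgebra (Ideal.span (Set.range x)) (x i)) :=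
    Ideal.span {algebraMap A (blowupAlgebra (Ideal.span (Set.range x)) (x i)) (x i)} ⊔
      Ideal.span (Set.range fun j : {j : Fin r // j ≠ i} => blowupAlgebra.frac x i j.1) with h𝔞def
  obtain ⟨ε, hε⟩ := exists_quotient_directionCentre_equiv x i hx
  have hε' : ∀ a : A, ε (Ideal.Quotient.mk 𝔞 (algebraMap A _ a)) = Ideal.Quotient.mk _ a := hε
  have hcomp : (ε.toRingHom.comp (Ideal.Quotient.mk 𝔞)).comp (algebraMap A _) = Ideal.Quotient.mk (Ideal.span (Set.range x)) :=
    RingHom.ext fun a => by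
      rw [RingHom.comp_apply, RingHom.comp_apply]
      exact hε' a
  -- the image of `𝔞 + P·B` in `B ⧸ 𝔞`, carried by `ε`, is `P ⧸ I`
  have hmap : ((𝔞 ⊔ P.map (algebraMap A _)).map (Ideal.Quotient.mk 𝔞)).map ε.toRingHom =
      P.map (Ideal.Quotient.mk (Ideal.span (Set.range x))) := by
    rw [Ideal.map_sup, Ideal.map_quotient_self, bot_sup_eq, Ideal.map_map, Ideal.map_map, hcomp]
  have hback : 𝔞 ⊔ P.map (algebraMap A _) = ((𝔞 ⊔ P.map (algebraMap A _)).map (Ideal.Quotient.mk 𝔞)).comap (Ideal.Quotient.mk 𝔞) := by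
    rw [Ideal.comap_map_of_surjective _ Ideal.Quotient.mk_surjective, ← RingHom.ker_eq_comap_bot, Ideal.mk_ker]
    exact (sup_eq_left.mpr le_sup_left).symm
  have hQ : (𝔞 ⊔ P.map (algebraMap A _)).map (Ideal.Quotient.mk 𝔞) =
      (P.map (Ideal.Quotient.mk (Ideal.span (Set.range x)))).comap ε.toRingHom := by
    rw [← hmap, Ideal.comap_map_of_bijective ε.toRingHom (by exact ε.bijective)]
  haveI hPI : (P.map (Ideal.Quotient.mk (Ideal.span (Set.range x)))).IsPrime :=
    Ideal.map_isPrime_of_surjective Ideal.Quotient.mk_surjective (by rwa [Ideal.mk_ker])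
  refine ⟨?_, ?_⟩
  · rw [hback, hQ]
    infer_instance
  · ext a
    rw [Ideal.mem_comap, hback, Ideal.mem_comap, hQ, Ideal.mem_comap]
    change ε (Ideal.Quotient.mk 𝔞 (algebraMap A _ a)) ∈ _ ↔ _
    rw [hε', Ideal.mem_quotient_iff_mem_sup, sup_eq_left.mpr hIP]

/-! ### The local ring `B_𝔔 ⧸ 𝔞 B_𝔔` as a quotient of `A` -/

variable {S : Type*} [CommRing S] [Algebra (blowupAlgebra (Ideal.span (Set.range x)) (x i)) S]

/-- For `A` local, a prime `𝔔 ⊇ 𝔞` of the chart algebra over `𝔪_A`, and `s ∉ 𝔔`: `s ≡ u/1 (mod 𝔞)` for a UNIT `u` of `A`. [folklore] -/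
theorem exists_unit_sub_algebraMap_mem_directionCentre [IsLocalRing A]
    {𝔔 : Ideal (blowupAlgebra (Ideal.span (Set.range x)) (x i))}
    (h𝔞𝔔 : Ideal.span {algebraMap A (blowupAlgebra (Ideal.span (Set.range x)) (x i)) (x i)} ⊔
        Ideal.span (Set.range fun j : {j : Fin r // j ≠ i} => blowupAlgebra.frac x i j.1) ≤ 𝔔)
    (h𝔔 : 𝔔.comap (algebraMap A _) = maximalIdeal A)
    {s : blowupAlgebra (Ideal.span (Set.range x)) (x i)} (hs : s ∉ 𝔔) :
    ∃ u : Aˣ, s - algebraMap A (blowupAlgebra (Ideal.span (Set.range x)) (x i)) (u : A) ∈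
      Ideal.span {algebraMap A (blowupAlgebra (Ideal.span (Set.range x)) (x i)) (x i)} ⊔
        Ideal.span (Set.range fun j : {j : Fin r // j ≠ i} => blowupAlgebra.frac x i j.1) := by
  obtain ⟨a, ha⟩ := exists_sub_algebraMap_mem_directionCentre x i s
  have ha𝔪 : a ∉ maximalIdeal A := fun h => by
    have h1 : algebraMap A (blowupAlgebra (Ideal.span (Set.range x)) (x i)) a ∈ 𝔔 := by rw [← Ideal.mem_comap, h𝔔]; exact h
    have h2 := 𝔔.add_mem (h𝔞𝔔 ha) h1
    rw [sub_add_cancel] at h2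
    exact hs h2
  have hu : IsUnit a := by
    by_contra h
    exact ha𝔪 ((IsLocalRing.mem_maximalIdeal a).mpr h)
  exact ⟨hu.unit, by simpa using ha⟩

/-- **`A → B_𝔔 ⧸ 𝔞B_𝔔` is surjective** (`A` local, `𝔔 ⊇ 𝔞` a prime of the chart algebra over `𝔪_A`, `S = B_𝔔`): a fraction `b/s`
has `b ≡ a/1`, `s ≡ u/1` modulo `𝔞` with `u` a unit of `A`, so `b/s ≡ (a u⁻¹)/1`. [folklore] -/
theorem surjective_mk_map_directionCentre_comp [IsLocalRing A]
    (𝔔 : Ideal (blowupAlgebra (Ideal.span (Set.range x)) (x i))) [𝔔.IsPrime] [IsLocalization.AtPrime S 𝔔]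
    (h𝔞𝔔 : Ideal.span {algebraMap A (blowupAlgebra (Ideal.span (Set.range x)) (x i)) (x i)} ⊔
        Ideal.span (Set.range fun j : {j : Fin r // j ≠ i} => blowupAlgebra.frac x i j.1) ≤ 𝔔)
    (h𝔔 : 𝔔.comap (algebraMap A _) = maximalIdeal A) :
    Function.Surjective ((Ideal.Quotient.mk ((Ideal.span {algebraMap A (blowupAlgebra (Ideal.span (Set.range x)) (x i)) (x i)} ⊔
        Ideal.span (Set.range fun j : {j : Fin r // j ≠ i} => blowupAlgebra.frac x i j.1)).map
          (algebraMap (blowupAlgebra (Ideal.span (Set.range x)) (x i)) S))).comp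
      ((algebraMap (blowupAlgebra (Ideal.span (Set.range x)) (x i)) S).comp (algebraMap A _))) := by
  set 𝔞 : Ideal (blowupAlgebra (Ideal.span (Set.range x)) (x i)) :=
    Ideal.span {algebraMap A (blowupAlgebra (Ideal.span (Set.range x)) (x i)) (x i)} ⊔
      Ideal.span (Set.range fun j : {j : Fin r // j ≠ i} => blowupAlgebra.frac x i j.1) with h𝔞def
  set π := Ideal.Quotient.mk (𝔞.map (algebraMap (blowupAlgebra (Ideal.span (Set.range x)) (x i)) S)) with hπ
  intro q
  obtain ⟨t, rfl⟩ := Ideal.Quotient.mk_surjective q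
  obtain ⟨⟨b, s⟩, rfl⟩ := IsLocalization.mk'_surjective 𝔔.primeCompl t
  obtain ⟨ab, hab⟩ := exists_sub_algebraMap_mem_directionCentre x i b
  obtain ⟨u, hu⟩ := exists_unit_sub_algebraMap_mem_directionCentre x i h𝔞𝔔 h𝔔 (s := s.1) s.2
  refine ⟨ab * ↑u⁻¹, ?_⟩
  have h1 : π (algebraMap (blowupAlgebra (Ideal.span (Set.range x)) (x i)) S s.1) = π (algebraMap (blowupAlgebra (Ideal.span (Set.range x)) (x i)) S (algebraMap A (blowupAlgebra (Ideal.span (Set.range x)) (x i)) (u : A))) := by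
    rw [Ideal.Quotient.mk_eq_mk_iff_sub_mem, ← map_sub]
    exact Ideal.mem_map_of_mem _ hu
  have h2 : π (algebraMap (blowupAlgebra (Ideal.span (Set.range x)) (x i)) S b) = π (algebraMap (blowupAlgebra (Ideal.span (Set.range x)) (x i)) S (algebraMap A (blowupAlgebra (Ideal.span (Set.range x)) (x i)) ab)) := by
    rw [Ideal.Quotient.mk_eq_mk_iff_sub_mem, ← map_sub]
    exact Ideal.mem_map_of_mem _ hab
  have h3 : π (IsLocalization.mk' S b s) * π (algebraMap (blowupAlgebra (Ideal.span (Set.range x)) (x i)) S s.1) = π (algebraMap (blowupAlgebra (Ideal.span (Set.range x)) (x i)) S b) := by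
    rw [← map_mul, IsLocalization.mk'_spec]
  have hunit : π (algebraMap (blowupAlgebra (Ideal.span (Set.range x)) (x i)) S (algebraMap A (blowupAlgebra (Ideal.span (Set.range x)) (x i)) (u : A))) * π (algebraMap (blowupAlgebra (Ideal.span (Set.range x)) (x i)) S (algebraMap A (blowupAlgebra (Ideal.span (Set.range x)) (x i)) (↑u⁻¹ : A))) = 1 := by
    rw [← map_mul, ← map_mul, ← map_mul, Units.mul_inv, map_one, map_one, map_one]
  change π (algebraMap (blowupAlgebra (Ideal.span (Set.range x)) (x i)) S (algebraMap A (blowupAlgebra (Ideal.span (Set.range x)) (x i)) (ab * ↑u⁻¹))) = π (IsLocalization.mk' S b s)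
  calc π (algebraMap (blowupAlgebra (Ideal.span (Set.range x)) (x i)) S (algebraMap A (blowupAlgebra (Ideal.span (Set.range x)) (x i)) (ab * ↑u⁻¹)))
      = π (algebraMap (blowupAlgebra (Ideal.span (Set.range x)) (x i)) S (algebraMap A (blowupAlgebra (Ideal.span (Set.range x)) (x i)) ab)) * π (algebraMap (blowupAlgebra (Ideal.span (Set.range x)) (x i)) S (algebraMap A (blowupAlgebra (Ideal.span (Set.range x)) (x i)) (↑u⁻¹ : A))) := by
        rw [map_mul, map_mul, map_mul]
    _ = π (IsLocalization.mk' S b s) * π (algebraMap (blowupAlgebra (Ideal.span (Set.range x)) (x i)) S s.1) *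
          π (algebraMap (blowupAlgebra (Ideal.span (Set.range x)) (x i)) S (algebraMap A (blowupAlgebra (Ideal.span (Set.range x)) (x i)) (↑u⁻¹ : A))) := by rw [h3, h2]
    _ = π (IsLocalization.mk' S b s) * (π (algebraMap (blowupAlgebra (Ideal.span (Set.range x)) (x i)) S (algebraMap A (blowupAlgebra (Ideal.span (Set.range x)) (x i)) (u : A))) *
          π (algebraMap (blowupAlgebra (Ideal.span (Set.range x)) (x i)) S (algebraMap A (blowupAlgebra (Ideal.span (Set.range x)) (x i)) (↑u⁻¹ : A)))) := by rw [h1, mul_assoc]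
    _ = π (IsLocalization.mk' S b s) := by rw [hunit, mul_one]

/-- **The kernel of `A → B_𝔔 ⧸ 𝔞B_𝔔` is `I`** (`A` local, `x` quasi-regular, `𝔔 ⊇ 𝔞` a prime of the chart algebra over `𝔪_A`,
`S = B_𝔔`): if `a/1 ∈ 𝔞B_𝔔` then `a·t ∈ 𝔞` for some `t ∉ 𝔔`, `t ≡ u/1` with `u` a unit, so `a u ∈ 𝔞 ∩ A = I`. [folklore] -/
theorem comap_map_directionCentre [IsLocalRing A] (hx : IsQuasiRegular x)
    (𝔔 : Ideal (blowupAlgebra (Ideal.span (Set.range x)) (x i))) [𝔔.IsPrime] [IsLocalization.AtPrime S 𝔔]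
    (h𝔞𝔔 : Ideal.span {algebraMap A (blowupAlgebra (Ideal.span (Set.range x)) (x i)) (x i)} ⊔
        Ideal.span (Set.range fun j : {j : Fin r // j ≠ i} => blowupAlgebra.frac x i j.1) ≤ 𝔔)
    (h𝔔 : 𝔔.comap (algebraMap A _) = maximalIdeal A) :
    ((Ideal.span {algebraMap A (blowupAlgebra (Ideal.span (Set.range x)) (x i)) (x i)} ⊔
          Ideal.span (Set.range fun j : {j : Fin r // j ≠ i} => blowupAlgebra.frac x i j.1)).map
        (algebraMap (blowupAlgebra (Ideal.span (Set.range x)) (x i)) S)).comap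
      ((algebraMap (blowupAlgebra (Ideal.span (Set.range x)) (x i)) S).comp (algebraMap A _)) = Ideal.span (Set.range x) := by
  set 𝔞 : Ideal (blowupAlgebra (Ideal.span (Set.range x)) (x i)) :=
    Ideal.span {algebraMap A (blowupAlgebra (Ideal.span (Set.range x)) (x i)) (x i)} ⊔
      Ideal.span (Set.range fun j : {j : Fin r // j ≠ i} => blowupAlgebra.frac x i j.1) with h𝔞def
  have h𝔞A : 𝔞.comap (algebraMap A _) = Ideal.span (Set.range x) := comap_algebraMap_directionCentre x i hx
  apply le_antisymm
  · intro a ha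
    rw [Ideal.mem_comap, RingHom.comp_apply, IsLocalization.mem_map_algebraMap_iff 𝔔.primeCompl S] at ha
    obtain ⟨⟨⟨b', hb'⟩, s⟩, hs⟩ := ha
    dsimp only at hs
    rw [← map_mul] at hs
    obtain ⟨c, hc⟩ := IsLocalization.exists_of_eq (M := 𝔔.primeCompl) hs
    have hmem : algebraMap A (blowupAlgebra (Ideal.span (Set.range x)) (x i)) a * (s.1 * c.1) ∈ 𝔞 := by
      have h : algebraMap A (blowupAlgebra (Ideal.span (Set.range x)) (x i)) a * (s.1 * c.1) = c.1 * b' := by rw [← hc]; ring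
      rw [h]
      exact 𝔞.mul_mem_left _ hb'
    have hsc : s.1 * c.1 ∉ 𝔔 := fun h => (‹𝔔.IsPrime›.mem_or_mem h).elim s.2 c.2
    obtain ⟨u, hu⟩ := exists_unit_sub_algebraMap_mem_directionCentre x i h𝔞𝔔 h𝔔 hsc
    have h2 : algebraMap A (blowupAlgebra (Ideal.span (Set.range x)) (x i)) (a * u) ∈ 𝔞 := by
      have h : algebraMap A (blowupAlgebra (Ideal.span (Set.range x)) (x i)) (a * u) =
          algebraMap A (blowupAlgebra (Ideal.span (Set.range x)) (x i)) a * (s.1 * c.1) - algebraMap A (blowupAlgebra (Ideal.span (Set.range x)) (x i)) a * (s.1 * c.1 - algebraMap A (blowupAlgebra (Ideal.span (Set.range x)) (x i)) (u : A)) := by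
        rw [map_mul]; ring
      rw [h]
      exact 𝔞.sub_mem hmem (𝔞.mul_mem_left _ hu)
    have h3 : a * u ∈ Ideal.span (Set.range x) := by
      rw [← h𝔞A, Ideal.mem_comap]
      exact h2
    exact (Ideal.mul_unit_mem_iff_mem _ u.isUnit).mp h3
  · intro a ha
    have h : algebraMap A (blowupAlgebra (Ideal.span (Set.range x)) (x i)) a ∈ 𝔞 := by
      rw [← Ideal.mem_comap, h𝔞A]
      exact ha
    exact Ideal.mem_map_of_mem _ h

end Chart

end Summit.ResolutionOfSingularities.ResolutionOfSingularities.Cruxes.EquisingularLiftNat.Sections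

end
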